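import Summits.ValiantsHypothesis.ValiantsHypothesis.Theorems.KPlusLogSqLawTropicalBLexStrict
import Summits.ValiantsHypothesis.ValiantsHypothesis.Theorems.KPlusLogSqLawTropicalBSplitDefs

/-!
# Route `KPlusLogSqLaw`, crux `TropicalB` — lex designs: the chain length is paid for by LONG CARRIES

HONEST FRAMING.  Support file toward the registered stubs `stub_tropThin` / `stub_tropFat` of the crux `TropicalB`
(ledger item `stmt-ValiantsHypothesis-19771`, route `KPlusLogSqLaw`; cell `pub-symmetroid`, seat val-sym-trop-p4, 2026-08-26).
Companion of `…TropicalBShortSteps` (same odometer argument, with an exceptional set of steps; self-contained); nothing asserted about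
`TropicalB` in general, `Lifting`, `KPlusLogSqLaw`, `MatrixDescartes` or `VP ≠ VNP`.

THE BOUND (`mul_steps_add_le_of_longSteps`, `steps_le_longCarries`).  Exponent values super-increasing by the size; `p₀, …, pₙ`
a dominant sign-alternating chain; `ℓ ≥ 1`; let `J = #{k : step k changes more than ℓ columns}` (the LONG CARRIES).  Then

  `n ≤ m·(J + 1)·(ℓ + 1)^K`.

So at every threshold `ℓ` the chain is LINEAR in `m` up to the number of long carries: each carry changing more than `ℓ`
columns buys at most one more budget `m·(ℓ+1)^K`.  SHIFT-THREE (`C(m+2,2) − 1` terms, `m − 1` carries that are `m`-cycles)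
is the extremal shape: `J + 1 = m` long carries, each followed by a linear sweep.  For the cell's `K = 4` fork: a cubic lex
family on `m` nodes must contain, for every fixed `ℓ`, `Ω(m² / (ℓ+1)^4)` steps changing more than `ℓ` columns each.

PROOF.  As in `…ShortSteps`, with the count of a value dropping by at most `ℓ` at a short step and by at most `m` at a long
one: `#{level = V₀} ≤ m·(J+1) + ℓ·#{level > V₀}` (`card_level_eq_le_of_long`), then the same descending induction with `m`
replaced by `m·(J+1)` (`mul_card_level_ge_add_le_of_long`).

[folklore] (odometer / amortised digit counting).
-/

-- `Summit.ValiantsHypothesis.ValiantsHypothesis.…` repeats a component by the D-0017 layout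
-- (single-conjunct summit), which the `dupNamespace` linter flags; the name is mandated.
set_option linter.dupNamespace false
set_option autoImplicit false

namespace Summit.ValiantsHypothesis.ValiantsHypothesis.Theorems.LacunarySymmetroidMatrixDescartes.TropicalCensus

open Summit.ValiantsHypothesis.ValiantsHypothesis.Theorems.MatrixDescartes.Negative
open Finset

section LongCarries

variable {m K : ℕ}

/-- one step: the count of a value drops by at most the number of changed columns of that step. -/
theorem count_le_count_succ_add_card (d : Fin K → ℕ) {n : ℕ} (p : Fin (n + 1) → Equiv.Perm (Fin m) × (Fin m → Fin K))
    (k : Fin n) (V : ℕ) :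
    (univ.filter fun i => d ((p k.castSucc).2 i) = V).card ≤ (univ.filter fun i => d ((p k.succ).2 i) = V).card +
      (univ.filter fun i : Fin m => (p k.castSucc).1 i ≠ (p k.succ).1 i ∨ (p k.castSucc).2 i ≠ (p k.succ).2 i).card := by
  calc (univ.filter fun i => d ((p k.castSucc).2 i) = V).card
      ≤ ((univ.filter fun i => d ((p k.succ).2 i) = V) ∪ (univ.filter fun i : Fin m =>
          (p k.castSucc).1 i ≠ (p k.succ).1 i ∨ (p k.castSucc).2 i ≠ (p k.succ).2 i)).card := by
        refine card_le_card fun i hi => ?_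
        rw [mem_union, mem_filter, mem_filter]
        rw [mem_filter] at hi
        by_cases hc : (p k.castSucc).2 i = (p k.succ).2 i
        · exact Or.inl ⟨mem_univ _, hc ▸ hi.2⟩
        · exact Or.inr ⟨mem_univ _, Or.inr hc⟩
    _ ≤ _ := card_union_le _ _

/-- **per-value count with long carries.**  Level function `L` as in `card_level_eq_le`; steps outside `Long` change at most `ℓ`
columns.  Then `#{level = V₀} ≤ m·(#Long + 1) + ℓ·#{level > V₀}`. [folklore] -/
theorem card_level_eq_le_of_long (d : Fin K → ℕ) {n : ℕ} (p : Fin (n + 1) → Equiv.Perm (Fin m) × (Fin m → Fin K))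
    (ℓ : ℕ) (Long : Finset (Fin n))
    (hshort : ∀ k : Fin n, k ∉ Long → (univ.filter fun i : Fin m =>
      (p k.castSucc).1 i ≠ (p k.succ).1 i ∨ (p k.castSucc).2 i ≠ (p k.succ).2 i).card ≤ ℓ)
    (L : Fin n → ℕ)
    (hrise : ∀ k, (univ.filter fun i => d ((p k.castSucc).2 i) = L k).card <
      (univ.filter fun i => d ((p k.succ).2 i) = L k).card)
    (hstay : ∀ k D, L k < D →
      (univ.filter fun i => d ((p k.castSucc).2 i) = D).card = (univ.filter fun i => d ((p k.succ).2 i) = D).card)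
    (V₀ : ℕ) :
    (univ.filter fun k : Fin n => L k = V₀).card ≤
      m * (Long.card + 1) + ℓ * (univ.filter fun k : Fin n => V₀ < L k).card := by
  set c : Fin (n + 1) → ℤ := fun j => ((univ.filter fun i => d ((p j).2 i) = V₀).card : ℤ) with hc
  set δ : Fin n → ℤ := fun k => c k.succ - c k.castSucc with hδ
  have htel : ∑ k, δ k = c (Fin.last n) - c 0 := by
    have h2 : ∑ j : Fin (n + 1), c j = c 0 + ∑ k : Fin n, c k.succ := Fin.sum_univ_succ c
    have h3 : ∑ j : Fin (n + 1), c j = ∑ k : Fin n, c k.castSucc + c (Fin.last n) := Fin.sum_univ_castSucc c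
    simp only [hδ, sum_sub_distrib]
    linarith
  have hcm : ∀ j, c j ≤ m := by
    intro j
    simp only [hc]
    have := card_le_univ (univ.filter fun i => d ((p j).2 i) = V₀)
    rw [Fintype.card_fin] at this
    exact_mod_cast this
  have hc0 : ∀ j, 0 ≤ c j := fun j => by simp only [hc]; positivity
  have hup : ∀ k, L k = V₀ → 1 ≤ δ k := by
    intro k hk
    have := hrise k
    rw [hk] at this
    simp only [hδ, hc]
    omega
  have hstay' : ∀ k, L k < V₀ → δ k = 0 := by
    intro k hk
    have := hstay k V₀ hk
    simp only [hδ, hc, this, sub_self]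
  -- drops: `≥ −ℓ` at short steps, `≥ −m` always
  have hdropS : ∀ k, k ∉ Long → -(ℓ : ℤ) ≤ δ k := by
    intro k hk
    have h1 := count_le_count_succ_add_card d p k V₀
    have h2 := hshort k hk
    simp only [hδ, hc]
    omega
  have hdropL : ∀ k, -(m : ℤ) ≤ δ k := by
    intro k
    have h1 := hcm k.castSucc
    have h2 := hc0 k.succ
    simp only [hδ]
    linarith
  have hsplit : ∑ k, δ k = ∑ k ∈ univ.filter (fun k => L k = V₀), δ k +
      (∑ k ∈ univ.filter (fun k => L k < V₀), δ k + ∑ k ∈ univ.filter (fun k => V₀ < L k), δ k) := by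
    rw [← sum_filter_add_sum_filter_not univ (fun k => L k = V₀)]
    congr 1
    rw [← sum_filter_add_sum_filter_not (univ.filter fun k => ¬ L k = V₀) (fun k => L k < V₀), filter_filter, filter_filter]
    congr 1
    · apply sum_congr _ (fun _ _ => rfl); ext k; simp only [mem_filter, mem_univ, true_and]; omega
    · apply sum_congr _ (fun _ _ => rfl); ext k; simp only [mem_filter, mem_univ, true_and]; omega
  have h1 : ((univ.filter fun k => L k = V₀).card : ℤ) ≤ ∑ k ∈ univ.filter (fun k => L k = V₀), δ k := by
    rw [card_eq_sum_ones, Nat.cast_sum]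
    exact sum_le_sum fun k hk => by simpa using hup k (mem_filter.mp hk).2
  have h2 : ∑ k ∈ univ.filter (fun k => L k < V₀), δ k = 0 :=
    sum_eq_zero fun k hk => hstay' k (mem_filter.mp hk).2
  -- the high-level steps: split into short and long
  have h3 : -((ℓ : ℤ) * (univ.filter fun k => V₀ < L k).card) - (m : ℤ) * Long.card ≤
      ∑ k ∈ univ.filter (fun k => V₀ < L k), δ k := by
    rw [← sum_filter_add_sum_filter_not (univ.filter fun k => V₀ < L k) (fun k => k ∈ Long)]
    have hA : -((m : ℤ) * Long.card) ≤ ∑ k ∈ (univ.filter fun k => V₀ < L k).filter (fun k => k ∈ Long), δ k := by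
      have hsub : ((univ.filter fun k => V₀ < L k).filter (fun k => k ∈ Long)).card ≤ Long.card :=
        card_le_card fun k hk => (mem_filter.mp hk).2
      have hsub' : (((univ.filter fun k => V₀ < L k).filter (fun k => k ∈ Long)).card : ℤ) ≤ Long.card := by
        exact_mod_cast hsub
      calc -((m : ℤ) * Long.card) ≤ -((m : ℤ) * ((univ.filter fun k => V₀ < L k).filter (fun k => k ∈ Long)).card) := by
            have : (0 : ℤ) ≤ m := by positivity
            nlinarith
        _ = ∑ k ∈ (univ.filter fun k => V₀ < L k).filter (fun k => k ∈ Long), (-(m : ℤ)) := by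
            rw [sum_const, nsmul_eq_mul]; ring
        _ ≤ _ := sum_le_sum fun k _ => hdropL k
    have hB : -((ℓ : ℤ) * (univ.filter fun k => V₀ < L k).card) ≤
        ∑ k ∈ (univ.filter fun k => V₀ < L k).filter (fun k => ¬ k ∈ Long), δ k := by
      have hsub : ((univ.filter fun k => V₀ < L k).filter (fun k => ¬ k ∈ Long)).card ≤
          (univ.filter fun k => V₀ < L k).card := card_filter_le _ _
      have hsub' : (((univ.filter fun k => V₀ < L k).filter (fun k => ¬ k ∈ Long)).card : ℤ) ≤
          (univ.filter fun k => V₀ < L k).card := by exact_mod_cast hsub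
      calc -((ℓ : ℤ) * (univ.filter fun k => V₀ < L k).card)
          ≤ -((ℓ : ℤ) * ((univ.filter fun k => V₀ < L k).filter (fun k => ¬ k ∈ Long)).card) := by
            have : (0 : ℤ) ≤ ℓ := by positivity
            nlinarith
        _ = ∑ k ∈ (univ.filter fun k => V₀ < L k).filter (fun k => ¬ k ∈ Long), (-(ℓ : ℤ)) := by
            rw [sum_const, nsmul_eq_mul]; ring
        _ ≤ _ := sum_le_sum fun k hk => hdropS k (mem_filter.mp hk).2
    linarith
  have hlast := hcm (Fin.last n)
  have hfirst := hc0 0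
  have key : ((univ.filter fun k => L k = V₀).card : ℤ) ≤
      m * (Long.card + 1) + ℓ * (univ.filter fun k => V₀ < L k).card := by
    linarith
  exact_mod_cast key

/-- **descending induction with long carries**: `ℓ·#{level ≥ V} + m(#Long+1) ≤ m(#Long+1)·(ℓ+1)^{#values ≥ V}`. [folklore] -/
theorem mul_card_level_ge_add_le_of_long (d : Fin K → ℕ) {n : ℕ}
    (p : Fin (n + 1) → Equiv.Perm (Fin m) × (Fin m → Fin K)) (ℓ : ℕ) (Long : Finset (Fin n))
    (hshort : ∀ k : Fin n, k ∉ Long → (univ.filter fun i : Fin m =>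
      (p k.castSucc).1 i ≠ (p k.succ).1 i ∨ (p k.castSucc).2 i ≠ (p k.succ).2 i).card ≤ ℓ)
    (L : Fin n → ℕ) (hLmem : ∀ k, L k ∈ univ.image d)
    (hrise : ∀ k, (univ.filter fun i => d ((p k.castSucc).2 i) = L k).card <
      (univ.filter fun i => d ((p k.succ).2 i) = L k).card)
    (hstay : ∀ k D, L k < D →
      (univ.filter fun i => d ((p k.castSucc).2 i) = D).card = (univ.filter fun i => d ((p k.succ).2 i) = D).card) :
    ∀ (c V : ℕ), ((univ.image d).filter fun D => V ≤ D).card = c →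
      ℓ * (univ.filter fun k : Fin n => V ≤ L k).card + m * (Long.card + 1) ≤ m * (Long.card + 1) * (ℓ + 1) ^ c := by
  intro c
  induction c with
  | zero =>
    intro V hV
    have h0 : (univ.filter fun k : Fin n => V ≤ L k) = ∅ := by
      refine filter_eq_empty_iff.mpr fun k _ hk => ?_
      have hmem : L k ∈ (univ.image d).filter fun D => V ≤ D := mem_filter.mpr ⟨hLmem k, hk⟩
      rw [card_eq_zero.mp hV] at hmem
      exact absurd hmem (notMem_empty _)
    rw [h0, card_empty, mul_zero, zero_add, pow_zero, mul_one]
  | succ c ih =>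
    intro V hV
    set S := (univ.image d).filter fun D => V ≤ D with hS
    have hSne : S.Nonempty := by rw [← card_pos, hV]; exact Nat.succ_pos c
    set V₀ := S.min' hSne with hV₀
    have hV₀mem : V₀ ∈ S := min'_mem S hSne
    have hlev : ∀ k, V ≤ L k → V₀ ≤ L k := fun k hk => min'_le S _ (mem_filter.mpr ⟨hLmem k, hk⟩)
    have hsplit : (univ.filter fun k : Fin n => V ≤ L k).card =
        (univ.filter fun k : Fin n => L k = V₀).card + (univ.filter fun k : Fin n => V₀ + 1 ≤ L k).card := by
      rw [← card_union_of_disjoint]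
      · congr 1
        ext k
        simp only [mem_filter, mem_union, mem_univ, true_and]
        have hVV₀ : V ≤ V₀ := (mem_filter.mp hV₀mem).2
        constructor
        · intro hk; have := hlev k hk; omega
        · intro hk; rcases hk with hk | hk <;> omega
      · rw [disjoint_filter]; intro k _ h1; omega
    have hcard : ((univ.image d).filter fun D => V₀ + 1 ≤ D).card = c := by
      have hE : ((univ.image d).filter fun D => V₀ + 1 ≤ D) = S.erase V₀ := by
        ext D
        simp only [hS, mem_filter, mem_erase]
        have hVV₀ : V ≤ V₀ := (mem_filter.mp hV₀mem).2
        constructor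
        · rintro ⟨hD, hle⟩; exact ⟨by omega, hD, by omega⟩
        · rintro ⟨hne, hD, hle⟩
          have : V₀ ≤ D := min'_le S D (mem_filter.mpr ⟨hD, hle⟩)
          exact ⟨hD, by omega⟩
      rw [hE, card_erase_of_mem hV₀mem, hV]
      rfl
    have hIH := ih (V₀ + 1) hcard
    have hM := card_level_eq_le_of_long d p ℓ Long hshort L hrise hstay V₀
    have hgt : (univ.filter fun k : Fin n => V₀ < L k) = (univ.filter fun k : Fin n => V₀ + 1 ≤ L k) := by
      ext k; simp only [mem_filter, mem_univ, true_and]; omega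
    rw [hgt] at hM
    rw [hsplit]
    set M := (univ.filter fun k : Fin n => L k = V₀).card
    set U := (univ.filter fun k : Fin n => V₀ + 1 ≤ L k).card
    set m' := m * (Long.card + 1)
    calc ℓ * (M + U) + m' ≤ ℓ * (m' + ℓ * U + U) + m' := by nlinarith
      _ = (ℓ + 1) * (ℓ * U + m') := by ring
      _ ≤ (ℓ + 1) * (m' * (ℓ + 1) ^ c) := Nat.mul_le_mul_left _ hIH
      _ = m' * (ℓ + 1) ^ (c + 1) := by ring

/-- **LONG CARRIES PAY FOR THE CHAIN** (lex regime).  Exponent values super-increasing by the size; along a dominant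
sign-alternating chain let `Long` contain every step changing more than `ℓ` columns.  Then `ℓ·n + m(#Long+1) ≤ m(#Long+1)(ℓ+1)^K`.
[folklore] -/
theorem mul_steps_add_le_of_longSteps (d : Fin K → ℕ) (hsup : ∀ l l' : Fin K, d l < d l' → m * d l < d l')
    (v ε : Fin m → Fin m → Fin K → ℤ) {n : ℕ} (θ : Fin (n + 1) → ℤ)
    (p : Fin (n + 1) → Equiv.Perm (Fin m) × (Fin m → Fin K)) (hθ : StrictMono θ)
    (hdom : ∀ k, IsDominant d v ε (θ k) (p k))
    (halt : ∀ k : Fin n, termSign ε (p k.castSucc) * termSign ε (p k.succ) < 0) (ℓ : ℕ) (Long : Finset (Fin n))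
    (hshort : ∀ k : Fin n, k ∉ Long → (univ.filter fun i : Fin m =>
      (p k.castSucc).1 i ≠ (p k.succ).1 i ∨ (p k.castSucc).2 i ≠ (p k.succ).2 i).card ≤ ℓ) :
    ℓ * n + m * (Long.card + 1) ≤ m * (Long.card + 1) * (ℓ + 1) ^ K := by
  have hex : ∀ k : Fin n, ∃ t : Fin K, (∀ D : ℕ, d t < D →
        (univ.filter fun i => d ((p k.castSucc).2 i) = D).card = (univ.filter fun i => d ((p k.succ).2 i) = D).card) ∧
      (univ.filter fun i => d ((p k.castSucc).2 i) = d t).card < (univ.filter fun i => d ((p k.succ).2 i) = d t).card :=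
    fun k => exists_lex_strict_step d hsup v ε (hθ (Fin.castSucc_lt_succ (i := k)))
      (Summit.ValiantsHypothesis.ValiantsHypothesis.Theorems.KPlusLogSqLaw.ne_succ_of_alternating ε p halt k)
      (hdom k.castSucc) (hdom k.succ)
  choose t ht using hex
  have h := mul_card_level_ge_add_le_of_long d p ℓ Long hshort (fun k => d (t k))
    (fun k => mem_image_of_mem d (mem_univ _)) (fun k => (ht k).2) (fun k D hD => (ht k).1 D hD) _ 0 rfl
  have hall : (univ.filter fun k : Fin n => 0 ≤ d (t k)) = univ := filter_true_of_mem fun k _ => Nat.zero_le _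
  rw [hall, card_univ, Fintype.card_fin] at h
  have hK : ((univ.image d).filter fun D => 0 ≤ D).card ≤ K := by
    calc ((univ.image d).filter fun D => 0 ≤ D).card ≤ (univ.image d).card := card_filter_le _ _
      _ ≤ (univ : Finset (Fin K)).card := card_image_le
      _ = K := by rw [card_univ, Fintype.card_fin]
  exact h.trans (Nat.mul_le_mul_left _ (Nat.pow_le_pow_right (Nat.succ_pos ℓ) hK))

/-- **LONG CARRIES PAY FOR THE CHAIN**, solved for `n`: with `ℓ ≥ 1` and `J = #{k : step k changes more than ℓ columns}`,
`n ≤ m·(J+1)·(ℓ+1)^K`.  At every threshold `ℓ` the chain is linear in `m` up to the number of long carries. [folklore] -/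
theorem steps_le_longCarries (d : Fin K → ℕ) (hsup : ∀ l l' : Fin K, d l < d l' → m * d l < d l')
    (v ε : Fin m → Fin m → Fin K → ℤ) {n : ℕ} (θ : Fin (n + 1) → ℤ)
    (p : Fin (n + 1) → Equiv.Perm (Fin m) × (Fin m → Fin K)) (hθ : StrictMono θ)
    (hdom : ∀ k, IsDominant d v ε (θ k) (p k))
    (halt : ∀ k : Fin n, termSign ε (p k.castSucc) * termSign ε (p k.succ) < 0) (ℓ : ℕ) (hℓ1 : 1 ≤ ℓ) :
    n ≤ m * ((univ.filter fun k : Fin n => ℓ < (univ.filter fun i : Fin m =>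
        (p k.castSucc).1 i ≠ (p k.succ).1 i ∨ (p k.castSucc).2 i ≠ (p k.succ).2 i).card).card + 1) * (ℓ + 1) ^ K := by
  set Long := univ.filter fun k : Fin n => ℓ < (univ.filter fun i : Fin m =>
        (p k.castSucc).1 i ≠ (p k.succ).1 i ∨ (p k.castSucc).2 i ≠ (p k.succ).2 i).card with hLong
  have hshort : ∀ k : Fin n, k ∉ Long → (univ.filter fun i : Fin m =>
      (p k.castSucc).1 i ≠ (p k.succ).1 i ∨ (p k.castSucc).2 i ≠ (p k.succ).2 i).card ≤ ℓ := by
    intro k hk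
    rw [hLong, mem_filter] at hk
    push Not at hk
    exact hk (mem_univ _)
  have h := mul_steps_add_le_of_longSteps d hsup v ε θ p hθ hdom halt ℓ Long hshort
  have hpos : 0 < m * (Long.card + 1) * (ℓ + 1) ^ K ∨ m = 0 := by
    rcases Nat.eq_zero_or_pos m with hm | hm
    · exact Or.inr hm
    · exact Or.inl (by positivity)
  nlinarith

end LongCarries

end Summit.ValiantsHypothesis.ValiantsHypothesis.Theorems.LacunarySymmetroidMatrixDescartes.TropicalCensus
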